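import Literature.Computability.Complexity.CodeFPFinite
import Summits.PneNP.PneNP.Theorems.SfmBlMachineWalks

/-!
# Line «sfm-bl», MACHINE LAYER M3a: enumerating the admissible closed leg-walks (stmt-PneNP-20523)

FRONTIER F-N1c; nothing here bears on P vs NP.

MACHINE-PLAN stage M3 computes, at every greedy step, the integer of p3's
`SfmBl.sum_cylinder_trace_pow_eq_parts` (`SfmBlTraceExpansion`): a signed count over the ADMISSIBLE PAIRS
`(L, L')` of remainder legs (`L' j` shares the left piece of `L j`, `L (j+1)` the right piece of `L' j`,
cyclically).  This file is the ENUMERATOR, by adjacency as p3 prescribes (never over all legs): the remainder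
legs `rlegs`, alternating sequences `e₀, e'₀, e₁, …` grown one leg at a time from every start leg — odd
positions share the LEFT piece of their predecessor, even positions the RIGHT piece (`aext`, `astep`,
`aseqsU` = spec, `aseqsC` = capped fold the machine runs, `aseqsC_eq_aseqsU`) — the closure test `isClosed`
(right piece of the last leg = right piece of the first), and the signed CONTRIBUTION of a closed sequence for a
prefix `(k, T₀)` (`contrib`: `± pw` if every free output is used an even number of times, sign = parity of the
uses of fixed outputs with `T₀ = true`, else `0`; `pw = 2^{#Pᶜ+1}` supplied by the glue) summed in `traceSum`.
Typing: `codeFP_aseqsC` (foldl, cap in unary), `codeFP_contrib`, `codeFP_traceSum`.  Spec side: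
`mem_aseqsU_iff` (the sequences of length `t+1` are exactly the `AdmSeq`-chains of remainder legs),
`length_aseqsU_le`.  The identification of `traceSum` with the right-hand side of
`sum_cylinder_trace_pow_eq_parts` (functions `Fin (q+1) → legs` vs. sequences) is M3b.
-/

set_option linter.dupNamespace false -- `Summit.PneNP.PneNP.…`: summit = sub-problem name (D-0017 single-conjunct layout)

namespace Summit.PneNP.PneNP.Theorems.SfmBlMachine

open Literature.Computability.Complexity CodeFP

/-! ## The spec (plain list functions) -/

/-- The default pieced leg (never a genuine item of a nonempty sequence). -/
def dleg : PLeg := (0, 0, 0, 0, 0, 0)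
/-- The remainder legs (label `0`). -/
def rlegs (plegs : List PLeg) (labels : List ℕ) : List PLeg :=
  ((labels.zip plegs).filter fun q => decide (q.1 = 0)).map Prod.snd

/-- Extend one alternating sequence (most recent leg first): at odd length share the LEFT piece of the last
leg, at even length the RIGHT piece. -/
def aext (rl : List PLeg) (s : List PLeg) : List (List PLeg) :=
  if s.length % 2 = 1 then (rl.filter fun y => labL y = labL (s.getD 0 dleg)).map fun y => y :: s
  else (rl.filter fun y => labR y = labR (s.getD 0 dleg)).map fun y => y :: s

/-- One round of extension of all sequences. -/
def astep (rl : List PLeg) (ss : List (List PLeg)) : List (List PLeg) := (ss.map (aext rl)).flatten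

/-- The start: one sequence per remainder leg. -/
def aseqs0 (rl : List PLeg) : List (List PLeg) := rl.map fun x => [x]

/-- All alternating sequences with `t + 1` legs (uncapped; the SPEC). -/
def aseqsU (rl : List PLeg) : ℕ → List (List PLeg)
  | 0 => aseqs0 rl
  | t + 1 => astep rl (aseqsU rl t)

/-- The capped enumeration the machine runs. -/
def aseqsC (rl : List PLeg) (cap : ℕ) (u : List Unit) : List (List PLeg) :=
  u.foldl (fun ss _ => (astep rl ss).take cap) (aseqs0 rl)

/-- Closure test: the right piece of the last leg is the right piece of the first leg. -/
def isClosed (s : List PLeg) : Bool := decide (labR (s.getD 0 dleg) = labR (s.reverse.getD 0 dleg))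

/-- The outputs used by a sequence. -/
def outs (s : List PLeg) : List ℕ := s.map fun x => x.1

/-- Every FREE output (`≥ k`) is used an even number of times. -/
def freeEven (k : ℕ) (os : List ℕ) : Bool := os.all fun o => decide (o < k) || decide (os.count o % 2 = 0)

/-- Parity of the uses of FIXED outputs (`< k`) whose prefix bit is `true`. -/
def sgnPar (k : ℕ) (T0 : List Bool) (os : List ℕ) : ℕ :=
  (os.filter fun o => decide (o < k) && T0.getD o false).length % 2

/-- The signed contribution `± pw` / `0` of a sequence for the prefix `(k, T₀)`. -/
def contrib (k : ℕ) (T0 : List Bool) (pw : ℤ) (s : List PLeg) : ℤ :=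
  if freeEven k (outs s) then (if sgnPar k T0 (outs s) = 0 then pw else -pw) else 0

/-- **The machine's value of `Σ_{T ⊇ T₀|P} tr(A_{R,T}^{2(q+1)})`** (with `pw = 2^{#Pᶜ+1}` and `|u| = 2q + 1`
rounds): the sum of the contributions of the closed alternating sequences. -/
def traceSum (k : ℕ) (T0 : List Bool) (pw : ℤ) (rl : List PLeg) (cap : ℕ) (u : List Unit) : ℤ :=
  (((aseqsC rl cap u).filter isClosed).map (contrib k T0 pw)).sum

/-! ## The cap is invisible below the true counts; counting -/

/-- The capped fold from an arbitrary start. -/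
theorem foldl_astep_take_eq (rl : List PLeg) (cap : ℕ) :
    ∀ (u : List Unit) (ss : List (List PLeg)),
      (∀ k, k ≤ u.length → (Nat.iterate (astep rl) k ss).length ≤ cap) →
      u.foldl (fun ss _ => (astep rl ss).take cap) ss = Nat.iterate (astep rl) u.length ss := by
  intro u
  induction u with
  | nil => intro ss _; rfl
  | cons _ u ih =>
    intro ss hcap
    rw [List.foldl_cons, List.length_cons, Function.iterate_succ_apply]
    have h1 : (astep rl ss).length ≤ cap := by simpa using hcap 1 (by simp)
    rw [List.take_of_length_le h1]
    exact ih _ fun k hk => by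
      have := hcap (k + 1) (by simpa using hk)
      rwa [Function.iterate_succ_apply] at this

/-- The uncapped sequences as an iterate. -/
theorem aseqsU_eq_iterate (rl : List PLeg) (t : ℕ) : aseqsU rl t = Nat.iterate (astep rl) t (aseqs0 rl) := by
  induction t with
  | zero => rfl
  | succ t ih => rw [aseqsU, ih, Function.iterate_succ_apply']

/-- If no true count up to round `|u|` exceeds the cap, the machine's enumeration IS the spec. -/
theorem aseqsC_eq_aseqsU (rl : List PLeg) (cap : ℕ) (u : List Unit)
    (h : ∀ k, k ≤ u.length → (aseqsU rl k).length ≤ cap) : aseqsC rl cap u = aseqsU rl u.length := by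
  rw [aseqsU_eq_iterate]
  exact foldl_astep_take_eq rl cap u (aseqs0 rl) fun k hk => by rw [← aseqsU_eq_iterate]; exact h k hk

/-- Growth of one round: a factor of at most the larger fibre size. -/
theorem length_astep_le (rl : List PLeg) (ss : List (List PLeg)) {D : ℕ}
    (hL : ∀ P, (rl.filter fun y => labL y = P).length ≤ D) (hR : ∀ P, (rl.filter fun y => labR y = P).length ≤ D) :
    (astep rl ss).length ≤ ss.length * D := by
  unfold astep
  rw [List.length_flatten, List.map_map]
  have : ∀ s ∈ ss, (List.length ∘ aext rl) s ≤ D := by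
    intro s _
    simp only [Function.comp, aext]
    split_ifs
    · rw [List.length_map]; exact hL _
    · rw [List.length_map]; exact hR _
  calc (ss.map (List.length ∘ aext rl)).sum ≤ (ss.map fun _ => D).sum := List.sum_le_sum this
    _ = ss.length * D := by rw [List.map_const', List.sum_replicate, smul_eq_mul]

/-- **Counting**: `#sequences with t+1 legs ≤ #remainder legs · D^t`. -/
theorem length_aseqsU_le (rl : List PLeg) {D : ℕ}
    (hL : ∀ P, (rl.filter fun y => labL y = P).length ≤ D) (hR : ∀ P, (rl.filter fun y => labR y = P).length ≤ D)
    (t : ℕ) : (aseqsU rl t).length ≤ rl.length * D ^ t := by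
  induction t with
  | zero => simp [aseqsU, aseqs0]
  | succ t ih =>
    calc (aseqsU rl (t + 1)).length ≤ (aseqsU rl t).length * D := length_astep_le rl _ hL hR
      _ ≤ rl.length * D ^ t * D := Nat.mul_le_mul_right _ ih
      _ = rl.length * D ^ (t + 1) := by rw [pow_succ, mul_assoc]

/-! ## What is enumerated: alternating chains of remainder legs -/

/-- ADMISSIBLE SEQUENCE (most recent first): items are remainder legs, and each leg shares with its
predecessor the LEFT piece at odd positions / the RIGHT piece at even positions (position = length of the tail). -/
def AdmSeq (rl : List PLeg) : List PLeg → Prop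
  | [] => False
  | [x] => x ∈ rl
  | y :: x :: s => y ∈ rl ∧ (if (x :: s).length % 2 = 1 then labL y = labL x else labR y = labR x) ∧ AdmSeq rl (x :: s)

/-- **The enumerated sequences with `t + 1` legs are exactly the admissible sequences of that length.** -/
theorem mem_aseqsU_iff (rl : List PLeg) : ∀ (t : ℕ) (s : List PLeg),
    s ∈ aseqsU rl t ↔ s.length = t + 1 ∧ AdmSeq rl s := by
  intro t
  induction t with
  | zero =>
    intro s
    simp only [aseqsU, aseqs0, List.mem_map, Nat.zero_add]
    constructor
    · rintro ⟨x, hx, rfl⟩; exact ⟨rfl, hx⟩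
    · rintro ⟨hlen, hadm⟩
      match s, hlen, hadm with
      | [x], _, hadm => exact ⟨x, hadm, rfl⟩
  | succ t ih =>
    intro s
    simp only [aseqsU, astep, List.mem_flatten, List.mem_map]
    constructor
    · rintro ⟨l, ⟨s', hs', rfl⟩, hs⟩
      obtain ⟨hlen', hadm'⟩ := (ih s').1 hs'
      unfold aext at hs
      obtain ⟨x, s₀, rfl⟩ : ∃ x s₀, s' = x :: s₀ := by
        cases s' with
        | nil => simp at hlen'
        | cons x s₀ => exact ⟨x, s₀, rfl⟩
      simp only [List.getD_cons_zero] at hs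
      split_ifs at hs with hpar
      · obtain ⟨y, hy, rfl⟩ := List.mem_map.1 hs
        rw [List.mem_filter, decide_eq_true_eq] at hy
        exact ⟨by rw [List.length_cons, hlen'], hy.1, by rw [if_pos hpar]; exact hy.2, hadm'⟩
      · obtain ⟨y, hy, rfl⟩ := List.mem_map.1 hs
        rw [List.mem_filter, decide_eq_true_eq] at hy
        exact ⟨by rw [List.length_cons, hlen'], hy.1, by rw [if_neg hpar]; exact hy.2, hadm'⟩
    · rintro ⟨hlen, hadm⟩
      match s, hlen, hadm with
      | y :: x :: s₀, hlen, hadm =>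
        obtain ⟨hy, hlink, hadm'⟩ := hadm
        have hlen' : (x :: s₀).length = t + 1 := by simpa using hlen
        refine ⟨aext rl (x :: s₀), ⟨x :: s₀, (ih _).2 ⟨hlen', hadm'⟩, rfl⟩, ?_⟩
        unfold aext
        simp only [List.getD_cons_zero]
        split_ifs at hlink ⊢ with hpar
        · exact List.mem_map.2 ⟨y, List.mem_filter.2 ⟨hy, by rw [decide_eq_true_eq]; exact hlink⟩, rfl⟩
        · exact List.mem_map.2 ⟨y, List.mem_filter.2 ⟨hy, by rw [decide_eq_true_eq]; exact hlink⟩, rfl⟩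

/-! ## Typing in the `CodeFP` algebra -/

section PolyTime

open Polynomial

/-- Code of a leg sequence. -/
abbrev seqE : List PLeg → List Bool := rawE plegE

/-- `plegE` is injective. -/
theorem plegE_injective : Function.Injective plegE :=
  pairE_injective natE_injective (pairE_injective natE_injective (pairE_injective natE_injective
    (pairE_injective natE_injective (pairE_injective natE_injective natE_injective))))

/-- The remainder legs are polynomial time (input `(pieced legs, labels)`). -/
theorem codeFP_rlegs : CodeFP (pairE (rawE plegE) (rawE natE)) (rawE plegE) (fun p => rlegs p.1 p.2) := by
  have hp : CodeFP (pairE unitE (pairE natE plegE)) bitE (fun t => decide (t.2.1 = 0)) :=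
    (natEq.comp ((snd _ _).fst'.pair (const _ (0 : ℕ)))).congr fun _ => rfl
  have hz : CodeFP (pairE (rawE plegE) (rawE natE)) (rawE (pairE natE plegE)) (fun p => p.2.zip p.1) :=
    ((rawZip natE plegE).comp ((snd _ _).pair (fst _ _))).congr fun _ => rfl
  exact ((map₀ (snd natE plegE)).comp ((filter hp).comp ((const _ ()).pair hz))).congr fun _ => rfl

/-- One alternating extension is polynomial time (input `(remainder legs, sequence)`). -/
theorem codeFP_aext : CodeFP (pairE (rawE plegE) seqE) (rawE seqE) (fun p => aext p.1 p.2) := by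
  have hx : CodeFP (pairE (rawE plegE) seqE) plegE (fun p => p.2.getD 0 dleg) :=
    ((rawGetOr plegE).comp ((snd _ _).pair ((const _ (0 : ℕ)).pair (const _ dleg)))).congr fun _ => rfl
  have hpar : CodeFP (pairE (rawE plegE) seqE) bitE (fun p => decide (p.2.length % 2 = 1)) :=
    (natEq.comp ((natMod.comp (((natLength plegE).comp (snd _ _)).pair (const _ (2 : ℕ)))).pair
      (const _ (1 : ℕ)))).congr fun _ => rfl
  have hL : CodeFP (pairE (pairE (rawE plegE) seqE) plegE) bitE
      (fun t => decide (labL t.2 = labL (t.1.2.getD 0 dleg))) :=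
    ((CodeFP.eq labE_injective).comp ((codeFP_labL.comp (snd _ _)).pair (codeFP_labL.comp (hx.comp (fst _ _))))).congr
      fun _ => rfl
  have hR : CodeFP (pairE (pairE (rawE plegE) seqE) plegE) bitE
      (fun t => decide (labR t.2 = labR (t.1.2.getD 0 dleg))) :=
    ((CodeFP.eq labE_injective).comp ((codeFP_labR.comp (snd _ _)).pair (codeFP_labR.comp (hx.comp (fst _ _))))).congr
      fun _ => rfl
  have hcons : CodeFP (pairE (pairE (rawE plegE) seqE) plegE) seqE (fun t => t.2 :: t.1.2) :=
    ((rawCons plegE).comp ((snd (pairE (rawE plegE) seqE) plegE).pair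
      (fst (pairE (rawE plegE) seqE) plegE).snd')).congr fun _ => rfl
  have hbrL : CodeFP (pairE (rawE plegE) seqE) (rawE seqE)
      (fun p => (p.1.filter fun y => decide (labL y = labL (p.2.getD 0 dleg))).map fun y => y :: p.2) :=
    ((map hcons).comp ((CodeFP.id _).pair ((filter hL).comp ((CodeFP.id _).pair (fst _ _))))).congr fun _ => rfl
  have hbrR : CodeFP (pairE (rawE plegE) seqE) (rawE seqE)
      (fun p => (p.1.filter fun y => decide (labR y = labR (p.2.getD 0 dleg))).map fun y => y :: p.2) :=
    ((map hcons).comp ((CodeFP.id _).pair ((filter hR).comp ((CodeFP.id _).pair (fst _ _))))).congr fun _ => rfl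
  exact (hpar.ite hbrL hbrR).congr fun p => by
    unfold aext
    by_cases h : p.2.length % 2 = 1
    · simp only [h, decide_true, if_true]
    · simp only [h, decide_false, Bool.false_eq_true, if_false]

/-- One round is polynomial time. -/
theorem codeFP_astep : CodeFP (pairE (rawE plegE) (rawE seqE)) (rawE seqE) (fun p => astep p.1 p.2) :=
  ((flatten seqE).comp (map codeFP_aext)).congr fun _ => rfl

/-- The start is polynomial time. -/
theorem codeFP_aseqs0 : CodeFP (rawE plegE) (rawE seqE) aseqs0 :=
  (map₀ (rawSingleton plegE)).congr fun _ => rfl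

/-- Invariant of the sequence fold after `r` rounds: items are remainder legs, length `≤ r + 1`. -/
def ASeqInv (rl : List PLeg) (r : ℕ) (ss : List (List PLeg)) : Prop :=
  ∀ s ∈ ss, (∀ x ∈ s, x ∈ rl) ∧ s.length ≤ r + 1

/-- The start satisfies the invariant. -/
theorem aseqInv_aseqs0 (rl : List PLeg) : ASeqInv rl 0 (aseqs0 rl) := by
  intro s hs
  unfold aseqs0 at hs
  obtain ⟨x, hx, rfl⟩ := List.mem_map.1 hs
  exact ⟨fun y hy => by rw [List.mem_singleton] at hy; rw [hy]; exact hx, by simp⟩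

/-- One capped round preserves the invariant. -/
theorem aseqInv_step (rl : List PLeg) (cap r : ℕ) {ss : List (List PLeg)} (h : ASeqInv rl r ss) :
    ASeqInv rl (r + 1) ((astep rl ss).take cap) := by
  intro s hs
  have hs' : s ∈ astep rl ss := List.mem_of_mem_take hs
  unfold astep at hs'
  rw [List.mem_flatten] at hs'
  obtain ⟨l, hl, hsl⟩ := hs'
  obtain ⟨s₀, hs₀, rfl⟩ := List.mem_map.1 hl
  obtain ⟨hmem, hlen⟩ := h s₀ hs₀
  unfold aext at hsl
  split_ifs at hsl
  all_goals
    obtain ⟨y, hy, rfl⟩ := List.mem_map.1 hsl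
    rw [List.mem_filter] at hy
    refine ⟨fun z hz => ?_, by rw [List.length_cons]; omega⟩
    rw [List.mem_cons] at hz
    rcases hz with rfl | hz
    · exact hy.1
    · exact hmem z hz

/-- The invariant along the fold, with the count bound. -/
theorem aseqInv_foldl (rl : List PLeg) (cap : ℕ) :
    ∀ (u : List Unit) (r : ℕ) (ss : List (List PLeg)), ASeqInv rl r ss → ss.length ≤ max rl.length cap →
      ASeqInv rl (r + u.length) (u.foldl (fun ss _ => (astep rl ss).take cap) ss) ∧
      (u.foldl (fun ss _ => (astep rl ss).take cap) ss).length ≤ max rl.length cap := by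
  intro u
  induction u with
  | nil => intro r ss h hl; exact ⟨by simpa using h, hl⟩
  | cons _ u ih =>
    intro r ss h _
    rw [List.foldl_cons, List.length_cons, show r + (u.length + 1) = (r + 1) + u.length by omega]
    exact ih (r + 1) _ (aseqInv_step rl cap r h) ((List.length_take_le _ _).trans (le_max_right _ _))

/-- **The capped sequence enumeration is polynomial time** (context `(remainder legs, cap)`, cap in UNARY). -/
theorem codeFP_aseqsC :
    CodeFP (pairE (pairE (rawE plegE) unE) (rawE unitE)) (rawE seqE) (fun p => aseqsC p.1.1 p.1.2 p.2) := by
  have hstep : CodeFP (pairE (pairE (rawE plegE) unE) (pairE unitE (rawE seqE))) (rawE seqE)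
      (fun t => (astep t.1.1 t.2.2).take t.1.2) :=
    ((rawTakeUn seqE).comp ((fst _ _).snd'.pair (codeFP_astep.comp ((fst _ _).fst'.pair (snd _ _).snd')))).congr
      fun _ => rfl
  have hinit : CodeFP (pairE (rawE plegE) unE) (rawE seqE) (fun s => aseqs0 s.1) := codeFP_aseqs0.comp (fst _ _)
  have h := foldl (σ := List PLeg × ℕ) (α := Unit) (β := List (List PLeg))
    (eσ := pairE (rawE plegE) unE) (eα := unitE) (eβ := rawE seqE)
    (step := fun s _ ss => (astep s.1 ss).take s.2) (init := fun s => aseqs0 s.1) hstep hinit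
    (2 * X * (2 * ((X + 2) * (2 * X + 2)) + 2)) (fun s l₁ l₂ => by
      obtain ⟨rl, cap⟩ := s
      set n := (pairE (pairE (rawE plegE) unE) (rawE unitE) ((rl, cap), l₁ ++ l₂)).length with hn
      have hR : (rawE plegE rl).length ≤ n := by
        rw [hn]; simp only [pairE_apply, length_boolPair]; omega
      have hcap : cap ≤ n := by
        rw [hn]; simp only [pairE_apply, length_boolPair, length_unE]; omega
      have hl₁ : l₁.length ≤ n := by
        have := length_le_length_rawE unitE (l₁ ++ l₂)
        rw [List.length_append] at this
        rw [hn]; simp only [pairE_apply, length_boolPair]; omega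
      have hrl : rl.length ≤ n := (length_le_length_rawE plegE rl).trans hR
      obtain ⟨hinv, hlen⟩ := aseqInv_foldl rl cap l₁ 0 (aseqs0 rl) (aseqInv_aseqs0 rl)
        (by unfold aseqs0; rw [List.length_map]; exact le_max_left _ _)
      rw [Nat.zero_add] at hinv
      set st := l₁.foldl (fun ss _ => (astep rl ss).take cap) (aseqs0 rl)
      have hcount : st.length ≤ 2 * n := hlen.trans (max_le (hrl.trans (by omega)) (hcap.trans (by omega)))
      have hitem : ∀ sq ∈ st, (seqE sq).length ≤ (n + 2) * (2 * n + 2) := by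
        intro sq hsq
        obtain ⟨hmem, hl⟩ := hinv sq hsq
        have := length_rawE_le_of_forall (e := plegE) (l := sq) (B := n)
          fun x hx => by have := length_item_le_length_rawE plegE (hmem x hx); omega
        exact this.trans (Nat.mul_le_mul (by omega) le_rfl)
      have hstate := length_rawE_le_of_forall hitem
      have heval : (2 * X * (2 * ((X + 2) * (2 * X + 2)) + 2) : Polynomial ℕ).eval n
          = 2 * n * (2 * ((n + 2) * (2 * n + 2)) + 2) := by simp
      show (rawE seqE st).length ≤ _
      rw [heval]
      exact hstate.trans (Nat.mul_le_mul_right _ hcount))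
  exact h.congr fun p => rfl

/-- The closure test is polynomial time. -/
theorem codeFP_isClosed : CodeFP seqE bitE isClosed := by
  have h0 : CodeFP seqE plegE (fun s => s.getD 0 dleg) :=
    ((rawGetOr plegE).comp ((CodeFP.id _).pair ((const _ (0 : ℕ)).pair (const _ dleg)))).congr fun _ => rfl
  have h1 : CodeFP seqE plegE (fun s => s.reverse.getD 0 dleg) :=
    ((rawGetOr plegE).comp ((rawReverse plegE).pair ((const _ (0 : ℕ)).pair (const _ dleg)))).congr fun _ => rfl
  exact ((CodeFP.eq labE_injective).comp ((codeFP_labR.comp h0).pair (codeFP_labR.comp h1))).congr fun _ => rfl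

/-- The output list is polynomial time. -/
theorem codeFP_outs : CodeFP seqE (rawE natE) outs := (map₀ (fst natE _)).congr fun _ => rfl

/-- The free-outputs-even test is polynomial time (input `(k, outputs)`). -/
theorem codeFP_freeEven : CodeFP (pairE natE (rawE natE)) bitE (fun p => freeEven p.1 p.2) := by
  have hp : CodeFP (pairE (pairE natE (rawE natE)) natE) bitE
      (fun t => decide (t.2 < t.1.1) || decide (t.1.2.count t.2 % 2 = 0)) :=
    (natLt.comp ((snd _ _).pair (fst _ _).fst')).or
      ((natEq.comp ((natMod.comp ((rawCountNat.comp ((snd _ _).pair (fst _ _).snd')).pair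
        (const _ (2 : ℕ)))).pair (const _ (0 : ℕ)))).congr fun _ => rfl)
  exact ((all hp).comp ((CodeFP.id _).pair (snd _ _))).congr fun _ => rfl

/-- The sign parity is polynomial time (input `((k, T₀), outputs)`). -/
theorem codeFP_sgnPar : CodeFP (pairE (pairE natE (rawE bitE)) (rawE natE)) natE (fun p => sgnPar p.1.1 p.1.2 p.2) := by
  have hp : CodeFP (pairE (pairE natE (rawE bitE)) natE) bitE
      (fun t => decide (t.2 < t.1.1) && t.1.2.getD t.2 false) :=
    (natLt.comp ((snd _ _).pair (fst _ _).fst')).and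
      (((rawGetOr bitE).comp ((fst _ _).snd'.pair ((snd _ _).pair (const _ false)))).congr fun _ => rfl)
  exact (natMod.comp (((natLength natE).comp (filter hp)).pair (const _ (2 : ℕ)))).congr fun _ => rfl

/-- The contribution is polynomial time (input `(((k, T₀), pw), sequence)`). -/
theorem codeFP_contrib : CodeFP (pairE (pairE (pairE natE (rawE bitE)) intE) seqE) intE
    (fun p => contrib p.1.1.1 p.1.1.2 p.1.2 p.2) := by
  have hos : CodeFP (pairE (pairE (pairE natE (rawE bitE)) intE) seqE) (rawE natE) (fun p => outs p.2) :=
    codeFP_outs.comp (snd _ _)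
  have hfe : CodeFP (pairE (pairE (pairE natE (rawE bitE)) intE) seqE) bitE (fun p => freeEven p.1.1.1 (outs p.2)) :=
    codeFP_freeEven.comp ((fst _ _).fst'.fst'.pair hos)
  have hsp : CodeFP (pairE (pairE (pairE natE (rawE bitE)) intE) seqE) bitE
      (fun p => decide (sgnPar p.1.1.1 p.1.1.2 (outs p.2) = 0)) :=
    natEq.comp ((codeFP_sgnPar.comp ((fst _ _).fst'.pair hos)).pair (const _ (0 : ℕ)))
  have hpw : CodeFP (pairE (pairE (pairE natE (rawE bitE)) intE) seqE) intE (fun p => p.1.2) := (fst _ _).snd'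
  exact (hfe.ite (hsp.ite hpw (intNeg.comp hpw)) (const _ (0 : ℤ))).congr fun p => by
    unfold contrib
    by_cases h : freeEven p.1.1.1 (outs p.2) = true
    · simp only [h, if_true]
      by_cases h' : sgnPar p.1.1.1 p.1.1.2 (outs p.2) = 0
      · simp only [h', decide_true, if_true]
      · simp only [h', decide_false, Bool.false_eq_true, if_false]
    · simp only [h, if_false, Bool.false_eq_true]

/-- **The machine's trace sum is polynomial time** (input `(((remainder legs, cap), rounds), ((k, T₀), pw))`). -/
theorem codeFP_traceSum :
    CodeFP (pairE (pairE (pairE (rawE plegE) unE) (rawE unitE)) (pairE (pairE natE (rawE bitE)) intE)) intE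
      (fun p => traceSum p.2.1.1 p.2.1.2 p.2.2 p.1.1.1 p.1.1.2 p.1.2) := by
  have hcl : CodeFP (pairE unitE seqE) bitE (fun t => isClosed t.2) := codeFP_isClosed.comp (snd _ _)
  have hseqs : CodeFP (pairE (pairE (pairE (rawE plegE) unE) (rawE unitE)) (pairE (pairE natE (rawE bitE)) intE))
      (rawE seqE) (fun p => (aseqsC p.1.1.1 p.1.1.2 p.1.2).filter isClosed) :=
    ((filter hcl).comp ((const _ ()).pair (codeFP_aseqsC.comp (fst _ _)))).congr fun _ => rfl
  exact (intSum.comp ((map codeFP_contrib).comp ((snd _ _).pair hseqs))).congr fun _ => rfl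

end PolyTime

end Summit.PneNP.PneNP.Theorems.SfmBlMachine
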